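import Mathlib
import Summits.NavierStokesRegularity.NavierStokesRegularity.Theses.DirectionDissipationQuantum
import Summits.NavierStokesRegularity.NavierStokesRegularity.Theorems.TypeILiouvilleTypeIliouvilleNoTypeIINormalForm
import HarnessLib

/-!
# `DirectionDissipationQuantum.UnitViscosityReduction` — NoBlowup at unit viscosity implies NoBlowup
  at every viscosity (route `DirectionDissipationQuantum`, item stmt-NavierStokesRegularity-1925,
  support; GLUE, scaling)

PROOF. Tao's footnote-3 rescaling `v(s, x) = ν⁻¹ u(s/ν, x)`: if `(u, p)` at viscosity `ν` on `[0,T)`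
(classical, Leray–Hopf, rapidly decaying datum) had no smooth extension past `T`, it would be a
maximal smooth solution, and the tree's `isMaximalSmoothSolution_timeRescale_one` turns it into a
maximal smooth Leray–Hopf solution at viscosity `1` on `[0, νT)` with a rapidly decaying datum —
which the unit-viscosity hypothesis extends: contradiction.

HONEST FRAMING: pure scaling bookkeeping; nothing here bears on the regularity problem itself.
-/

noncomputable section

set_option linter.dupNamespace false

namespace Summit.NavierStokesRegularity.NavierStokesRegularity.Theorems

open Set
open Literature.Analysis Literature.Analysis.FluidPDE
open Summit.NavierStokesRegularity.NavierStokesRegularity.Theorems.TypeIliouvilleNoTypeII.EternalSplit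

/-- **Item stmt-NavierStokesRegularity-1925** (`DirectionDissipationQuantum.UnitViscosityReduction`):
NoBlowup for `ν = 1` implies NoBlowup for every `ν > 0` (viscosity rescaling). [this file; Tao2011 fn. 3] -/
theorem directionDissipationQuantum_unitViscosityReduction_proof :
    Summit.NavierStokesRegularity.NavierStokesRegularity.Theses.DirectionDissipationQuantum.UnitViscosityReduction := by
  unfold Summit.NavierStokesRegularity.NavierStokesRegularity.Theses.DirectionDissipationQuantum.UnitViscosityReduction
  intro h1 ν T hν hT u p hcl hLH hdec
  by_contra hext
  have hmax : IsMaximalSmoothSolution ν 0 u p T := ⟨hcl, hext⟩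
  obtain ⟨hmaxv, hLHv, hdecv⟩ := isMaximalSmoothSolution_timeRescale_one hν hT hmax hLH hdec
  exact hmaxv.2 (h1 (ν * T) (mul_pos hν hT) _ _ hmaxv.1 hLHv hdecv)

end Summit.NavierStokesRegularity.NavierStokesRegularity.Theorems

end
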